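import Summits.MatrixMultiplication.MatrixMultiplication.Theorems.ObstructionDescentUniversalOccurrenceTwoRectangleOddHook
import Summits.MatrixMultiplication.MatrixMultiplication.Theorems.ObstructionDescentUniversalOccurrenceTwoRectangleOddThree
import Summits.MatrixMultiplication.MatrixMultiplication.Theorems.ObstructionDescentUniversalOccurrenceTwoRectangleOddFive

set_option linter.dupNamespace false
set_option autoImplicit false

/-!
# Universal occurrence — two rectangles: the four-odd types with `ν₂ ≤ 5`, `ν₃ = ν₄ = 1` (decomp-mm · lens 3 · gen 44, summary K29–K31)

Route `route-MatrixMultiplication-ObstructionDescent` (sub-problem `MatrixMultiplication`, `ω(ℂ) = 2`); SUPPORT for the crux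
`NoOccurrenceObstruction` (`P_O`, item `stmt-MatrixMultiplication-29040`) through the universal-occurrence programme (NODE-g29…g44
of the decomp-mm cell, lens 3).  Nothing here proves `ω = 2` or closes an item; no `def`, no `sorry`, standard axioms.

**Claim** (`occurs_unitTensor_twoRectangle_fourOddTypes`).  Let `N ≥ 4` and let `ν ⊢ 2N` have sorted parts `a :: rest` with
`rest ∈ {[1,1,1], [3,1,1], [5,1,1]}` — i.e. `ν ∈ {(2N-3,1,1,1), (2N-5,3,1,1), (2N-7,5,1,1)}` (the first part and the floors
`N ≥ 4, 4, 6` are forced by `Σ ν = 2N` and monotonicity, except `N ≥ 4` for the odd hook, which is assumed).  Then the isotypic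
component of type `((2^N),(2^N),ν)` of `Sym^{2N}(ℂ^m ⊗ ℂ^m ⊗ ℂ^m)` does not vanish on the orbit closure of the unit tensor `⟨m⟩`
for EVERY `m ≥ N + 2`.  These are the first three uniform families of the FOUR-ODD class of the two-rectangular sector (third
legs with four odd parts), which no floor design (`m = N`, K23/K26/K27) and — by weights — no design over `⟨N+1⟩` can reach; the
certificates are the STOREY LAW (`…TwoRectangleStorey`) on lifted designs over `[N+2]` (`…OddHook`, `…OddThree`, `…OddFive`).

[cite: BurgisserIkenmeyer2011, §3.4 (Prop. 3.4), Thm. 4.4, Lemma 6.1] [cite: BurgisserIkenmeyer2017, §5, Thm. 5.9 (proof of (2)),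
eq. (3.4)] [cite: Landsberg2017, §9.1.1]
-/

noncomputable section

open scoped BigOperators

namespace Summit.MatrixMultiplication.MatrixMultiplication.Theorems.ObstructionCalculus

open Literature.Computability.AlgebraicComplexity
open Literature.NumberTheory.DiophantineGeometry

/-- **Every type `((2^N),(2^N),ν)` with `ν ∈ {(2N-3,1,1,1), (2N-5,3,1,1), (2N-7,5,1,1)}`, `N ≥ 4`, occurs for `⟨m⟩`, all
`m ≥ N + 2`.** [cite: BurgisserIkenmeyer2011, Thm. 4.4] [cite: BurgisserIkenmeyer2017, Thm. 5.9 (proof of (2))] -/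
theorem occurs_unitTensor_twoRectangle_fourOddTypes {N m : ℕ} (hN : 4 ≤ N) (hNm : N + 2 ≤ m)
    {lam : Fin 3 → Nat.Partition (N * 2)} (h0 : lam 0 = Nat.Partition.rectangle N 2)
    (h1 : lam 1 = Nat.Partition.rectangle N 2) {a : ℕ} {rest : List ℕ}
    (hrest : rest ∈ [[1, 1, 1], [3, 1, 1], [5, 1, 1]])
    (h2 : (lam 2).sortedParts = a :: rest) :
    isotypicSum₁ (lam 0) (isotypicSum₂ (lam 1) (isotypicSum₃ (lam 2)
      (kroneckerPow (unitTensor ℂ m) (N * 2)))) ≠ 0 := by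
  have hsum : a + rest.sum = N * 2 := by
    have h := (lam 2).sum_sortedParts
    rwa [h2, List.sum_cons] at h
  have hsort : ∀ b ∈ rest, b ≤ a := by
    have h := List.sortedGE_iff_pairwise.mp (lam 2).sortedGE_sortedParts
    rw [h2, List.pairwise_cons] at h
    exact h.1
  simp only [List.mem_cons, List.not_mem_nil, or_false] at hrest
  rcases hrest with rfl | rfl | rfl
  · -- `ν = (2N-3, 1, 1, 1)`
    simp only [List.sum_cons, List.sum_nil] at hsum
    obtain rfl : a = 2 * N - 3 := by omega
    exact occurs_unitTensor_twoRectangle_oddHook hN hNm h0 h1 h2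
  · -- `ν = (2N-5, 3, 1, 1)`
    simp only [List.sum_cons, List.sum_nil] at hsum
    obtain rfl : a = 2 * N - 5 := by omega
    exact occurs_unitTensor_twoRectangle_oddThree hN hNm h0 h1 h2
  · -- `ν = (2N-7, 5, 1, 1)`
    simp only [List.sum_cons, List.sum_nil] at hsum
    have h5 := hsort 5 (by simp)
    obtain rfl : a = 2 * N - 7 := by omega
    exact occurs_unitTensor_twoRectangle_oddFive (by omega) hNm h0 h1 h2

end Summit.MatrixMultiplication.MatrixMultiplication.Theorems.ObstructionCalculus

end
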